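import Summits.CriticalPhenomena.PercolationContinuityZ3.Theorems.PercNearOneGluingNoHeavyLowerTailFourCopyHubExpect
import HarnessLib

/-! — part 1: integer tables of a source type and the evaluator
# `NoHeavyLowerTail` (stmt-CriticalPhenomena-4575) — FOUR-copy switching certificates, VIII: the TRIANGLE bound
# (two-step programs on all pairs of target copies), its soundness, and the `E₃` conclusion from a computed bound

Support file (prover prim-ineq-prove-3 gen 8; `--supports stmt-CriticalPhenomena-4575`).  No named facts, no sorries.

The certificates of gen 6 (referee-verified for all finite graphs in the compute lane) use ALL 72 two-step programs
`u → T₁ ; v → T₂` (`{T₁,T₂} ⊆ {1,2,3}`), including those with target set `{1,2}`, which couple the two side copies.  For a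
weakly well-formed certificate `c` (`Cert.wfT`: no hub condition) the bound of this file is
`VT c πX t₁ t₂ t₃ = max over the refined states s₁ of copy 1 and s₃ of copy 3 of F(s₁,s₃) + Σ_w max_{p ∈ opts(t₂,w)} G_w(p; s₁,s₃)`:
given `s₁` and `s₃`, copy `2` and its `X`-blocks decouple (every program reads at most one root letter of copy `2`).  The
per-source-type tables (`mkTriTabs`) are plain integer tables of `e1`/`e2` (no packing: this bound is meant to be EVALUATED —
`decide` by compiled evaluation — not reduced by the kernel; ≈ 10⁹ elementary operations for the full certificate).
SOUNDNESS (`Sreal_le_VT`): `Sreal c τ x ≤ VT c (type x₀) (type x₁) (type x₂) (type x₃)`.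
CONCLUSION (`e3_nonneg_of_triOK`): if `triOK c E D = true` — the symmetrisation of the cell function
`U = Pc + D·Tc − V` is nonnegative at every sorted cell, `V` the table of all `VT` values — then `E₃(A,B,C) ≥ 0` for the
target events on every finite graph (measure preservation `E[S] = E[Pc]`, `S ≤ V(code)`, `E[U(code)] ≥ 0`).
-/

namespace Summit.CriticalPhenomena.PercolationContinuityZ3.Theorems

namespace FourCopyHub

open Finset Literature.Probability.Percolation Literature.Probability.Percolation.DecisionTree
open Literature.Probability.Percolation.Gladkov ThreePointLB GroupThreePointLB FourPointAtoms SwitchRelax SwitchingK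
open scoped Classical

/-! ### Integer tables of a source type -/

/-- Table type of a one-step program: `[p][a][b]`. [this work] -/
abbrev Tb3 := List (List (List ℤ))
/-- Table type of a two-step program: `[p₁][t][p₂][a]`. [this work] -/
abbrev Tb4 := List (List (List (List ℤ)))

/-- Lookup `[p][a][b]`. [this work] -/
def lk3 (T : Tb3) (p : Ty) (a b : ℕ) : ℤ := lk (lk (lk T p.val []) a []) b bot
/-- Lookup `[p₁][t][p₂][a]`. [this work] -/
def lk4 (T : Tb4) (p1 t p2 : Ty) (a : ℕ) : ℤ := lk (lk (lk (lk T p1.val []) t.val []) p2.val []) a bot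

/-- Index range of the class arguments of the tables. [this work] -/
def Cert.nA (c : Cert) : ℕ := max c.ncls c.ncl2

/-- The table `[p][a][b] ↦ e1 c πX q p a b` of a one-step program (via the clean-class table). [this work] -/
def tab1 (c : Cert) (CT : List (List (List ℕ))) (q : P1) : Tb3 :=
  allTys.map fun p => (List.range c.nA).map fun a => (List.range c.nA).map fun b =>
    lmax ((lk (lk CT q.u.val []) p.val []).map fun o => q.lam o a b)

/-- The table `[p₁][t][p₂][a] ↦ e2 c πX q p₁ t p₂ a` of a two-step program (relevant `p₂`; `bot` otherwise). [this work] -/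
def tab2 (c : Cert) (CT : List (List (List ℕ))) (MT : List (List (List (List (List ℕ))))) (q : P2) : Tb4 :=
  allTys.map fun p1 => allTys.map fun t => allTys.map fun p2 => (List.range c.nA).map fun a =>
    e2T (fun cf cs => q.lam cf cs a) (lk (lk CT q.u.val []) p1.val []) (lk (lk (lk (lk MT q.u.val []) q.v.val []) t.val []) p2.val [])

/-- The programs of a certificate with their tables, GROUPED by kind and by the representatives of their root letters.
[this work] -/
structure TriTabs where
  /-- `[u]`: tables of the one-step programs `u' → 1` with `rep u' = u` -/
  o1 : List (List Tb3)
  /-- `[w]`: one-step programs `u' → 2` with `rep u' = w` -/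
  o2 : List (List Tb3)
  /-- one-step programs `u → 3`: `(table, rep u)` -/
  o3 : List (Tb3 × Fin 4)
  /-- `[u]`: programs `u' → 1 ; v → 3` with `rep u' = u`: `(table, rep v)` -/
  p13 : List (List (Tb4 × Fin 4))
  /-- `[u]`: programs `u' → 3 ; v → 1` with `rep v = u`: `(table, rep u')` -/
  p31 : List (List (Tb4 × Fin 4))
  /-- `[w]`: programs `u' → 2 ; v → 3` with `rep u' = w`: `(table, rep v)` -/
  p23 : List (List (Tb4 × Fin 4))
  /-- `[w]`: programs `u' → 3 ; v → 2` with `rep v = w`: `(table, rep u')` -/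
  p32 : List (List (Tb4 × Fin 4))
  /-- `[u][w]`: tables of the programs `u' → 1 ; v → 2` with `rep u' = u`, `rep v = w` -/
  p12 : List (List (List Tb4))
  /-- `[w][u]`: tables of the programs `u' → 2 ; v → 1` with `rep u' = w`, `rep v = u` -/
  p21 : List (List (List Tb4))

/-- The tables of a source type. [this work] -/
@[noinline] def mkTriTabsAux (πX : Ty) (O : List (P1 × Tb3)) (W : List (P2 × Tb4)) : TriTabs :=
  let L4 := List.finRange 4
  { o1 := L4.map fun u => (O.filter fun e => e.1.T = 1 ∧ rep πX e.1.u = u).map fun e => e.2,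
    o2 := L4.map fun w => (O.filter fun e => e.1.T = 2 ∧ rep πX e.1.u = w).map fun e => e.2,
    o3 := (O.filter fun e => e.1.T = 3).map fun e => (e.2, rep πX e.1.u),
    p13 := L4.map fun u => (W.filter fun e => e.1.T1 = 1 ∧ e.1.T2 = 3 ∧ rep πX e.1.u = u).map fun e => (e.2, rep πX e.1.v),
    p31 := L4.map fun u => (W.filter fun e => e.1.T1 = 3 ∧ e.1.T2 = 1 ∧ rep πX e.1.v = u).map fun e => (e.2, rep πX e.1.u),
    p23 := L4.map fun w => (W.filter fun e => e.1.T1 = 2 ∧ e.1.T2 = 3 ∧ rep πX e.1.u = w).map fun e => (e.2, rep πX e.1.v),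
    p32 := L4.map fun w => (W.filter fun e => e.1.T1 = 3 ∧ e.1.T2 = 2 ∧ rep πX e.1.v = w).map fun e => (e.2, rep πX e.1.u),
    p12 := L4.map fun u => L4.map fun w =>
      (W.filter fun e => e.1.T1 = 1 ∧ e.1.T2 = 2 ∧ rep πX e.1.u = u ∧ rep πX e.1.v = w).map fun e => e.2,
    p21 := L4.map fun w => L4.map fun u =>
      (W.filter fun e => e.1.T1 = 2 ∧ e.1.T2 = 1 ∧ rep πX e.1.u = w ∧ rep πX e.1.v = u).map fun e => e.2 }

/-- Tables of all programs (clean/messy class tables passed in). [this work] -/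
@[noinline] def mkTriTabsCM (c : Cert) (πX : Ty) (CT : List (List (List ℕ))) (MT : List (List (List (List (List ℕ))))) : TriTabs :=
  mkTriTabsAux πX (c.one.map fun q => (q, tab1 c CT q)) (c.two.map fun q => (q, tab2 c CT MT q))

/-- The tables of a source type. [this work] -/
def mkTriTabs (c : Cert) (πX : Ty) : TriTabs := mkTriTabsCM c πX (CTab c πX) (MTab c πX)

/-! ### The evaluator -/

/-- Array lookup with default (no `Option`). [this work] -/
def gA {α : Type} (A : Array α) (i : ℕ) (d : α) : α := A.getD i d
/-- Two-level integer array lookup. [this work] -/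
def gA2 (A : Array (Array ℤ)) (i j : ℕ) : ℤ := gA (gA A i #[]) j bot
/-- Three-level integer array lookup. [this work] -/
def gA3 (A : Array (Array (Array ℤ))) (i j k : ℕ) : ℤ := gA (gA (gA A i #[]) j #[]) k bot

/-- List to array of a row function over `Ty`. [this work] -/
def rowA (f : Ty → ℤ) : Array ℤ := (allTys.map f).toArray
/-- `Array` table over `Fin 4 × Ty`. [this work] -/
def mkA2 (f : Fin 4 → Ty → ℤ) : Array (Array ℤ) := ((List.finRange 4).map fun u => rowA (f u)).toArray
/-- `Array` table over `ℕ < n`, `Fin 4`, `Ty`. [this work] -/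
def mkA3 (n : ℕ) (f : ℕ → Fin 4 → Ty → ℤ) : Array (Array (Array ℤ)) := ((List.range n).map fun a => mkA2 (f a)).toArray

/-- `Array` table over `Fin 4`, `Ty`, `Ty`, `ℕ < n`. [this work] -/
def mkA4 (n : ℕ) (f : Fin 4 → Ty → Ty → ℕ → ℤ) : Array (Array (Array (Array ℤ))) :=
  ((List.finRange 4).map fun u => (allTys.map fun t => (allTys.map fun p =>
    ((List.range n).map fun a => f u t p a).toArray).toArray).toArray).toArray

/-- The option lists of a source type: `[t][w] ↦ optsF πX t w`. [this work] -/
def mkOT (πX : Ty) : List (List (List Ty)) := allTys.map fun t => (List.finRange 4).map fun w => optsF πX t w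
/-- Lookup in the option table. [this work] -/
def otL (OT : List (List (List Ty))) (t : Ty) (w : Fin 4) : List Ty := lk (lk OT t.val []) w.val []

section Eval

variable (c : Cert) (πX : Ty) (P : TriTabs) (OT : List (List (List Ty)))

/-- SPEC of the copy-1 letter value: programs `u' → 1` (rep `u`), `u' → 1 ; v → 3` (rep `u`), `u' → 3 ; v → 1`
(rep `v = u`), read at option `p₁` of letter `u`, hub state `s₃`, base types `t₁ t₂ t₃`. [this work] -/
def triA (t1 t2 t3 : Ty) (s3 : St4) (u : Fin 4) (p1 : Ty) : ℤ :=
  ((lk P.o1 u.val []).map fun T => lk3 T p1 (c.cls2 t2) (c.cls t3)).sum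
  + ((lk P.p13 u.val []).map fun e => lk4 e.1 p1 t3 (s3 e.2) (c.cls2 t2)).sum
  + ((lk P.p31 u.val []).map fun e => lk4 e.1 (s3 e.2) t1 p1 (c.cls2 t2)).sum

/-- SPEC of the hub-only part: one-step programs into copy 3. [this work] -/
def triF0 (t1 t2 : Ty) (s3 : St4) : ℤ := (P.o3.map fun e => lk3 e.1 (s3 e.2) (c.cls t1) (c.cls t2)).sum

/-- SPEC of the copy-2 fibre base at letter `w`, option `p`: `u' → 2`, `u' → 2 ; v → 3`, `u' → 3 ; v → 2`. [this work] -/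
def triG0 (t1 t2 t3 : Ty) (s3 : St4) (w : Fin 4) (p : Ty) : ℤ :=
  ((lk P.o2 w.val []).map fun T => lk3 T p (c.cls2 t1) (c.cls t3)).sum
  + ((lk P.p23 w.val []).map fun e => lk4 e.1 p t3 (s3 e.2) (c.cls2 t1)).sum
  + ((lk P.p32 w.val []).map fun e => lk4 e.1 (s3 e.2) t2 p (c.cls2 t1)).sum

/-- SPEC of the coupling of copy-2 letter `w` (option `p`) with copy-1 letter `u` (option `p₁`): the programs with
target set `{1,2}`. [this work] -/
def triH (t1 t2 t3 : Ty) (w u : Fin 4) (p p1 : Ty) : ℤ :=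
  ((lk (lk P.p12 u.val []) w.val []).map fun T => lk4 T p1 t2 p (c.cls2 t3)).sum
  + ((lk (lk P.p21 w.val []) u.val []).map fun T => lk4 T p t1 p1 (c.cls2 t3)).sum

/-- A column with letter `u` fixed to option `p`: the coupling row entry is added into the base. [this work] -/
def addCol (u : Fin 4) (p : Ty) (col : List (ℤ × Array (Array ℤ))) : List (ℤ × Array (Array ℤ)) :=
  col.map fun e => (e.1 + gA2 e.2 u.val p.val, e.2)

/-- The columns with letter `u` fixed to option `p`. [this work] -/
def addCols (u : Fin 4) (p : Ty) (G : List (List (ℤ × Array (Array ℤ)))) : List (List (ℤ × Array (Array ℤ))) :=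
  G.map (addCol u p)

/-- Best value of a column once the last letter is fixed to `p`. [this work] -/
def colBest (p : Ty) (col : List (ℤ × Array (Array ℤ))) : ℤ := lmax (col.map fun e => e.1 + gA2 e.2 (3 : Fin 4).val p.val)

/-- **The maximum over the states of copy 1**, by nested enumeration of the four letter options with incremental
column sums. [this work] -/
def triMax (O0 O1 O2 O3 : List Ty) (F0 : ℤ) (Atab : Array (Array ℤ)) (G : List (List (ℤ × Array (Array ℤ)))) : ℤ :=
  lmax (O0.map fun p0 =>
    let G1 := addCols 0 p0 G
    let a0 := F0 + gA2 Atab (0 : Fin 4).val p0.val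
    lmax (O1.map fun p1 =>
      let G2 := addCols 1 p1 G1
      let a1 := a0 + gA2 Atab (1 : Fin 4).val p1.val
      lmax (O2.map fun p2 =>
        let G3 := addCols 2 p2 G2
        let a2 := a1 + gA2 Atab (2 : Fin 4).val p2.val
        lmax (O3.map fun p3 =>
          a2 + gA2 Atab (3 : Fin 4).val p3.val + ((List.finRange 4).map fun w => colBest p3 (lk G3 w.val [])).sum))))

/-- Per-hub-state parts: `A13, G23` by `[a][u][p]` and `A31, G32` by `[u][t][p][a]` (sums of table slices). [this work] -/
structure S3Parts where
  /-- `[a][u][p₁] ↦ Σ_{u'→1 ; v→3, rep u' = u} e2(p₁, t₃, s₃(rep v); a)` -/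
  A13 : Array (Array (Array ℤ))
  /-- `[a][w][p] ↦ Σ_{u'→2 ; v→3, rep u' = w} e2(p, t₃, s₃(rep v); a)` -/
  G23 : Array (Array (Array ℤ))
  /-- `[u][t₁][p₁][a] ↦ Σ_{u'→3 ; v→1, rep v = u} e2(s₃(rep u'), t₁, p₁; a)` -/
  A31 : Array (Array (Array (Array ℤ)))
  /-- `[w][t₂][p][a] ↦ Σ_{u'→3 ; v→2, rep v = w} e2(s₃(rep u'), t₂, p; a)` -/
  G32 : Array (Array (Array (Array ℤ)))

/-- The per-hub-state parts. [this work] -/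
def mkS3Parts (t3 : Ty) (s3 : St4) : S3Parts where
  A13 := mkA3 c.nA fun a u p1 => ((lk P.p13 u.val []).map fun e => lk4 e.1 p1 t3 (s3 e.2) a).sum
  G23 := mkA3 c.nA fun a w p => ((lk P.p23 w.val []).map fun e => lk4 e.1 p t3 (s3 e.2) a).sum
  A31 := mkA4 c.nA fun u t1 p1 a => ((lk P.p31 u.val []).map fun e => lk4 e.1 (s3 e.2) t1 p1 a).sum
  G32 := mkA4 c.nA fun w t2 p a => ((lk P.p32 w.val []).map fun e => lk4 e.1 (s3 e.2) t2 p a).sum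

/-- Four-level array lookup. [this work] -/
def gA4 (A : Array (Array (Array (Array ℤ)))) (i j k l : ℕ) : ℤ := gA (gA (gA (gA A i #[]) j #[]) k #[]) l bot

/-- The row table `[t₁][a][u]` of copy 1 for a hub state: `p₁ ↦ O1[a][u][p₁] + A13[a][u][p₁] + A31[u][t₁][p₁][a]`.
[this work] -/
def aRows (O1 : Array (Array (Array ℤ))) (S : S3Parts) (nA : ℕ) : Array (Array (Array (Array ℤ))) :=
  (allTys.map fun t1 => ((List.range nA).map fun a => ((List.finRange 4).map fun u =>
    rowA fun p1 => gA3 O1 a u.val p1.val + gA3 S.A13 a u.val p1.val + gA4 S.A31 u.val t1.val p1.val a).toArray).toArray).toArray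

/-- The column bases `[t₂][a][w]` of copy 2 for a hub state: over the options `p` of `w` (in order),
`O2[a][w][p] + G23[a][w][p] + G32[w][t₂][p][a]`; zipped with the coupling rows of `(t₁,t₂)` later. [this work] -/
def gBase (O2 : Array (Array (Array ℤ))) (S : S3Parts) (nA : ℕ) (t2 : Ty) : Array (Array (List ℤ)) :=
  ((List.range nA).map fun a => ((List.finRange 4).map fun w =>
    (otL OT t2 w).map fun p => gA3 O2 a w.val p.val + gA3 S.G23 a w.val p.val + gA4 S.G32 w.val t2.val p.val a).toArray).toArray

/-- The `(t₁,t₂)`-table of a hub state from its parts, the one-step parts `O1, O2` (`[a][u][p]`, per `t₃`) and the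
coupling columns `Hall` (`[t₁][t₂][w] ↦ [(p, rows)]`). [this work] -/
@[noinline] def triRowsAux (Hall : List (List (List (List (Array (Array ℤ))))))
    (s3 : St4) (AR : Array (Array (Array (Array ℤ)))) (GB : Array (Array (Array (List ℤ)))) : List (List ℤ) :=
  allTys.map fun t1 => allTys.map fun t2 =>
    triMax (otL OT t1 0) (otL OT t1 1) (otL OT t1 2) (otL OT t1 3) (triF0 c P t1 t2 s3)
      (gA (gA AR t1.val #[]) (c.cls2 t2) #[])
      ((List.finRange 4).map fun w =>
        List.zip (gA (gA (gA GB t2.val #[]) (c.cls2 t1) #[]) w.val []) (lk (lk (lk Hall t1.val []) t2.val []) w.val []))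

/-- The `(t₁,t₂)`-table of a hub state `s₃`. [this work] -/
def triRows (t3 : Ty) (Hall : List (List (List (List (Array (Array ℤ)))))) (O1 O2 : Array (Array (Array ℤ)))
    (s3 : St4) : List (List ℤ) :=
  let S := mkS3Parts c P t3 s3
  triRowsAux c P OT Hall s3 (aRows O1 S c.nA) ((allTys.map fun t2 => gBase OT O2 S c.nA t2).toArray)

/-- The coupling columns of a hub base type: `[t₁][t₂][w] ↦ [rows [u][p₁]]` over the options `p` of `w` in
copy 2 (in order). [this work] -/
def triHall (t3 : Ty) : List (List (List (List (Array (Array ℤ))))) :=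
  allTys.map fun t1 => allTys.map fun t2 => (List.finRange 4).map fun w => (otL OT t2 w).map fun p =>
    mkA2 fun u p1 => triH c P t1 t2 t3 w u p p1

/-- One-step parts of a hub base type: `[a][u][p₁] ↦ Σ_{u'→1, rep u' = u} e1(p₁; a, cls t₃)` and the same for
copy 2. [this work] -/
def triO1 (t3 : Ty) : Array (Array (Array ℤ)) := mkA3 c.nA fun a u p1 => ((lk P.o1 u.val []).map fun T => lk3 T p1 a (c.cls t3)).sum
/-- See `triO1`. [this work] -/
def triO2 (t3 : Ty) : Array (Array (Array ℤ)) := mkA3 c.nA fun a w p => ((lk P.o2 w.val []).map fun T => lk3 T p a (c.cls t3)).sum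

/-- Elementwise maximum of two `15 × 15` tables. [this work] -/
def tmax (A B : List (List ℤ)) : List (List ℤ) := List.zipWith (fun r s => List.zipWith max r s) A B

/-- The bottom table. [this work] -/
def tbot : List (List ℤ) := allTys.map fun _ => allTys.map fun _ => bot

/-- Elementwise maximum over the hub states of the `(t₁,t₂)`-tables (precomputed per-`t₃` data passed in). [this work] -/
@[noinline] def triT3Aux (t3 : Ty) (Hall : List (List (List (List (Array (Array ℤ))))))
    (O1 O2 : Array (Array (Array ℤ))) : List (List ℤ) :=
  ((states πX t3).map fun s3 => triRows c P OT t3 Hall O1 O2 s3).foldr tmax tbot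

/-- The `(t₁,t₂)`-table of a hub base type: elementwise maximum over the hub states. [this work] -/
def triT3 (t3 : Ty) : List (List ℤ) := triT3Aux c πX P OT t3 (triHall c P OT t3) (triO1 c P t3) (triO2 c P t3)

end Eval

/-- All values of a source type from its tables: `[t₃][t₁][t₂]`. [this work] -/
@[noinline] def VTallP (c : Cert) (πX : Ty) (P : TriTabs) (OT : List (List (List Ty))) : List (List (List ℤ)) :=
  allTys.map fun t3 => triT3 c πX P OT t3

/-- All values of a source type: `[t₃][t₁][t₂]` (tables built once). [this work] -/
def VTall (c : Cert) (πX : Ty) : List (List (List ℤ)) := VTallP c πX (mkTriTabs c πX) (mkOT πX)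

/-- **THE TRIANGLE BOUND** `VT c πX t₁ t₂ t₃`. [this work] -/
def VT (c : Cert) (πX t1 t2 t3 : Ty) : ℤ := lk (lk (lk (VTall c πX) t3.val []) t1.val []) t2.val bot

/-- All values: `[πX][t₃][t₁][t₂]`. [this work] -/
def V4 (c : Cert) : List (List (List (List ℤ))) := allTys.map fun πX => VTall c πX

/-- Lookup of a cell `o = (πX, t₁, t₂, t₃)` in the value table. [this work] -/
def lkV (V : List (List (List (List ℤ)))) (o : St4) : ℤ :=
  lk (lk (lk (lk V (o 0).val []) (o 3).val []) (o 1).val []) (o 2).val bot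

/-- The slack cell function `U = Pc + D·Tc − V`. [this work] -/
def Ucell (c : Cert) (E : E3Target) (Dsc : ℕ) (V : List (List (List (List ℤ)))) (o : St4) : ℤ :=
  Pc c o + Dsc * Tc E (o 1) (o 2) (o 3) - lkV V o

/-- **THE CHECK**: the symmetrisation of `U` is nonnegative at every sorted cell. [this work] -/
@[noinline] def triOKV (c : Cert) (E : E3Target) (Dsc : ℕ) (V : List (List (List (List ℤ)))) : Bool :=
  allTys.all fun a => (allTys.filter fun b => a ≤ b).all fun b => (allTys.filter fun c' => b ≤ c').all fun c' =>
    (allTys.filter fun d => c' ≤ d).all fun d => decide (0 ≤ symS (Ucell c E Dsc V) (mk4 a b c' d))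

/-- **THE CHECK**: the symmetrisation of `U = Pc + D·Tc − V` is nonnegative at every sorted cell. [this work] -/
def triOK (c : Cert) (E : E3Target) (Dsc : ℕ) : Bool := triOKV c E Dsc (V4 c)

end FourCopyHub

end Summit.CriticalPhenomena.PercolationContinuityZ3.Theorems
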